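import Summits.FinalStateConjecture.FinalStateConjecture.Theses.ProbeNullTrace
import HarnessLib

/-!
# Birth skeleton — crux stmt-FinalStateConjecture-17471 `Theses.ProbeNullTrace.SettlingTraceNull` (S, rank 3)
# line `birth` (skeleton registrar planner-skel-stmt-FinalStateConjecture-17471-0, 2026-08-17; BC3 of run/shared/lean/lens3/_common/BC.md)

S (SettlingTraceNull): every admissible datum `D` all of whose MGHDs have complete `𝓘⁺` but one of which fails the
re-typed settled clause (`∃ O d, (∀ i, Kerr.IsSubextremal …) ∧ O = exteriorOf ∧ RaysStayInClosure ∧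
HasExhaustiveCharts ∧ IsFutureOriented`) is the centre of a tame (one fixed end), immersed, injective admissible
`k`-probe (`k ≥ 2`) whose punctured exceptional trace near `0` is `μH[k−1]`-null plus finitely many `C¹`-at-`0` walls.

THE CUT — the route header's own TWO-LAYER PLAN for S ("S1 = the extremal threshold is a wall (third-law
transversality), S2 = non-Kerr / non-decaying / N = ∞ exteriors … have (k−1)-null trace"), typed at the level where
the pieces COMPOSE: by the CLASS OF THE CENTRE, i.e. by two intrinsic properties of the failing development `𝒟`:
  WEAK 𝒟         := ∃ O d, O = exteriorOf 𝒟 d.charted ∧ RaysStayInClosure 𝒟 O ∧ HasExhaustiveCharts d ∧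
                    IsFutureOriented d      (the summit's settled clause MINUS strict sub-extremality: `|aᵢ| ≤ Mᵢ` is
                    built into `FinalStateDecomposition`; all three anti-vacuity honesty clauses of the 2026-08-16
                    audit are KEPT, so WEAK cannot be satisfied by junk charts any more than the summit's clause can);
  NULLCOMPLETE 𝒟 := every normalised future null ray from the data hypersurface has affine domain unbounded above
                    (`IsNormalisedNullRayFrom … p γ dom → ¬ BddAbove dom`, the Minkowski column of
                    `hasCompleteFutureNullInfinity_of_forall_not_bddAbove`; its failure under complete `𝓘⁺` is a
                    censored singularity reached by a ray from `Σ` — a black hole).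
`¬ SETTLED 𝒟` is the disjoint union of three classes, each owned by a different literature:

* `stub_extremalThresholdCentre` (EXT: `WEAK ∧ ¬ SETTLED` — the final state has an exactly extremal hole; third law /
  extremal critical collapse, Kehle–Unger; Aretakis barrier): such centres are probe-null (conclusion of S verbatim).
* `stub_nullCompleteCentre` (DISP: `¬ WEAK ∧ NULLCOMPLETE` — black-hole-free, censored, yet neither dispersing nor
  settling: an "eternal radiator"; large-data stability-of-Minkowski mechanism, Lichnerowicz / no-time-periodic
  rigidity): probe-null.
* `stub_blackHoleCentre` (BH: `¬ WEAK ∧ ¬ NULLCOMPLETE` — a censored black-hole spacetime whose exterior does not settle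
  honestly to finitely many Kerrs; Kerr basin + rigidity, Klainerman–Szeftel / GKS / DHRT / AIK; the
  SlowlyRotatingKerrFrontier barrier bites here): probe-null.

Each stub keeps the other hypothesis of S (all MGHDs of the centre have complete `𝓘⁺`) and the conclusion of S
verbatim, so each is a PROPER special case of S; none implies S or the summit cheaply (BC3 probes `bc/diag_*.lean` in the
registrar's folder: `exact?` "could not close the goal", `simpa`/`unfold; simpa` heartbeat-out at 400000, `aesop`
"failed after exhaustive search", 6/6 files), and S follows by a double case distinction on the failing development
(`SettlingTraceNull_of`, real proof, axioms propext/Classical.choice/Quot.sound; `settlingTraceNull_of_stubs :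
SettlingTraceNull` = the crux BY NAME modulo the three stubs).
Why by centre class and not by trace stratum: per-stratum statements along ONE shared probe do not compose at this
typing level — the probe is existential, and "for every tame probe" versions are false (a 2-parameter tame family may
lie inside a codimension-one stratum such as the extremal threshold).  The expected wall/dust structure inside each
class is recorded in the stub docstrings for crux-ideate / crux-plan to sharpen.

Signatures are DEF-FREE and self-contained (`open … in` prefixes; `Summit.FinalStateConjecture.*` auxiliaries fully
qualified), so they elaborate standalone wherever the route file is imported; the `Sig.*` legend repeats them
verbatim to give `SettlingTraceNull_of` named binders.
Disproof.lean: none exists for this crux at registration (`ledger crux ls stmt-FinalStateConjecture-17471`: no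
workfiles) — no `_false_without_` obligations to honour.  Negatives index (`ledger negatives --problem
FinalStateConjecture`, 1 entry: `not_UniformPhotonSphereChannels`, an ODE channel estimate): unrelated to every stub.
-/

set_option linter.dupNamespace false

open scoped Manifold MeasureTheory Topology Classical
open Literature.Geometry.Lorentzian

namespace Summit.FinalStateConjecture.FinalStateConjecture.Cruxes.SettlingTraceNull.Birth

open Summit.FinalStateConjecture.FinalStateConjecture.Theses.ProbeNullTrace (SettlingTraceNull)

/-! ## Legend: the three stub statements as named propositions (verbatim the registered signatures) -/

/-- Statement of `stub_extremalThresholdCentre` (EXT): centres whose failing MGHD settles honestly but only with an extremal hole are probe-null. -/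
def Sig.stub_extremalThresholdCentre : Prop :=
  open Literature.Geometry.Lorentzian in open scoped Manifold MeasureTheory in ∀ (X : Type) [TopologicalSpace X] [ChartedSpace E3 X] [IsManifold (𝓡 3) ((⊤ : ℕ∞) : WithTop ℕ∞) X] [T2Space X] [SecondCountableTopology X] [ConnectedSpace X], ∀ D ∈ admissibleVacuumData X, (∀ 𝒟 : VacuumCauchyDevelopment D, 𝒟.IsMaximal → Summit.FinalStateConjecture.HasCompleteNullInfinity 𝒟.toCauchyDevelopment) → (∃ 𝒟 : VacuumCauchyDevelopment D, 𝒟.IsMaximal ∧ (∃ (O : Set 𝒟.carrier) (d : FinalStateDecomposition 𝒟.toSpacetime O 2), O = Summit.FinalStateConjecture.exteriorOf 𝒟.toCauchyDevelopment d.charted ∧ Summit.FinalStateConjecture.RaysStayInClosure 𝒟.toCauchyDevelopment O ∧ Summit.FinalStateConjecture.HasExhaustiveCharts d ∧ Summit.FinalStateConjecture.IsFutureOriented d) ∧ ¬ (∃ (O : Set 𝒟.carrier) (d : FinalStateDecomposition 𝒟.toSpacetime O 2), (∀ i, Kerr.IsSubextremal (d.mass i) (d.spin i)) ∧ O = Summit.FinalStateConjecture.exteriorOf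 𝒟.toCauchyDevelopment d.charted ∧ Summit.FinalStateConjecture.RaysStayInClosure 𝒟.toCauchyDevelopment O ∧ Summit.FinalStateConjecture.HasExhaustiveCharts d ∧ Summit.FinalStateConjecture.IsFutureOriented d)) → ∃ (e : AFEnd X) (k : ℕ) (Φ : EuclideanSpace ℝ (Fin k) → InitialDataSet (𝓡 3) X), 2 ≤ k ∧ InitialDataSet.IsTameDataFamily e k Φ ∧ InitialDataSet.IsImmersedAtZero k Φ ∧ Function.Injective Φ ∧ Φ 0 = D ∧ (∀ c, Φ c ∈ admissibleVacuumData X) ∧ ∃ (δ : ℝ) (N : Set (EuclideanSpace ℝ (Fin k))) (m : ℕ) (g : Fin m → EuclideanSpace ℝ (Fin k) → ℝ) (L : Fin m → (EuclideanSpace ℝ (Fin k) →L[ℝ] ℝ)), 0 < δ ∧ μH[(k : ℝ) - 1] N = 0 ∧ (∀ i, HasFDerivAt (g i) (L i) 0 ∧ L i ≠ 0) ∧ ∀ c, ‖c‖ < δ → c ≠ 0 → ¬ (∀ 𝒟 : VacuumCauchyDevelopment (Φ c), 𝒟.IsMaximal → Summit.FinalStateConjecture.HasCompleteNullInfinity 𝒟.toCauchyDevelopment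 ∧ ∃ (O : Set 𝒟.carrier) (d : FinalStateDecomposition 𝒟.toSpacetime O 2), (∀ i, Kerr.IsSubextremal (d.mass i) (d.spin i)) ∧ O = Summit.FinalStateConjecture.exteriorOf 𝒟.toCauchyDevelopment d.charted ∧ Summit.FinalStateConjecture.RaysStayInClosure 𝒟.toCauchyDevelopment O ∧ Summit.FinalStateConjecture.HasExhaustiveCharts d ∧ Summit.FinalStateConjecture.IsFutureOriented d) → c ∈ N ∨ ∃ i, g i c = 0

/-- Statement of `stub_nullCompleteCentre` (DISP): centres whose failing MGHD has no honest Kerr decomposition although every normalised null ray from the data is future-complete are probe-null. -/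
def Sig.stub_nullCompleteCentre : Prop :=
  open Literature.Geometry.Lorentzian in open scoped Manifold MeasureTheory in ∀ (X : Type) [TopologicalSpace X] [ChartedSpace E3 X] [IsManifold (𝓡 3) ((⊤ : ℕ∞) : WithTop ℕ∞) X] [T2Space X] [SecondCountableTopology X] [ConnectedSpace X], ∀ D ∈ admissibleVacuumData X, (∀ 𝒟 : VacuumCauchyDevelopment D, 𝒟.IsMaximal → Summit.FinalStateConjecture.HasCompleteNullInfinity 𝒟.toCauchyDevelopment) → (∃ 𝒟 : VacuumCauchyDevelopment D, 𝒟.IsMaximal ∧ ¬ (∃ (O : Set 𝒟.carrier) (d : FinalStateDecomposition 𝒟.toSpacetime O 2), O = Summit.FinalStateConjecture.exteriorOf 𝒟.toCauchyDevelopment d.charted ∧ Summit.FinalStateConjecture.RaysStayInClosure 𝒟.toCauchyDevelopment O ∧ Summit.FinalStateConjecture.HasExhaustiveCharts d ∧ Summit.FinalStateConjecture.IsFutureOriented d) ∧ (∀ [𝒟.metric.HasLeviCivita], ∀ (p : X) (γ : ℝ → 𝒟.carrier) (dom : Set ℝ), 𝒟.metric.IsNormalisedNullRayFrom 𝒟.timeOrientation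 𝒟.embed 𝒟.normal p γ dom → ¬ BddAbove dom)) → ∃ (e : AFEnd X) (k : ℕ) (Φ : EuclideanSpace ℝ (Fin k) → InitialDataSet (𝓡 3) X), 2 ≤ k ∧ InitialDataSet.IsTameDataFamily e k Φ ∧ InitialDataSet.IsImmersedAtZero k Φ ∧ Function.Injective Φ ∧ Φ 0 = D ∧ (∀ c, Φ c ∈ admissibleVacuumData X) ∧ ∃ (δ : ℝ) (N : Set (EuclideanSpace ℝ (Fin k))) (m : ℕ) (g : Fin m → EuclideanSpace ℝ (Fin k) → ℝ) (L : Fin m → (EuclideanSpace ℝ (Fin k) →L[ℝ] ℝ)), 0 < δ ∧ μH[(k : ℝ) - 1] N = 0 ∧ (∀ i, HasFDerivAt (g i) (L i) 0 ∧ L i ≠ 0) ∧ ∀ c, ‖c‖ < δ → c ≠ 0 → ¬ (∀ 𝒟 : VacuumCauchyDevelopment (Φ c), 𝒟.IsMaximal → Summit.FinalStateConjecture.HasCompleteNullInfinity 𝒟.toCauchyDevelopment ∧ ∃ (O : Set 𝒟.carrier) (d : FinalStateDecomposition 𝒟.toSpacetime O 2), (∀ i, Kerr.IsSubextremal (d.mass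 i) (d.spin i)) ∧ O = Summit.FinalStateConjecture.exteriorOf 𝒟.toCauchyDevelopment d.charted ∧ Summit.FinalStateConjecture.RaysStayInClosure 𝒟.toCauchyDevelopment O ∧ Summit.FinalStateConjecture.HasExhaustiveCharts d ∧ Summit.FinalStateConjecture.IsFutureOriented d) → c ∈ N ∨ ∃ i, g i c = 0

/-- Statement of `stub_blackHoleCentre` (BH): centres whose failing MGHD has no honest Kerr decomposition and an incomplete normalised null ray from the data (a censored black hole) are probe-null. -/
def Sig.stub_blackHoleCentre : Prop :=
  open Literature.Geometry.Lorentzian in open scoped Manifold MeasureTheory in ∀ (X : Type) [TopologicalSpace X] [ChartedSpace E3 X] [IsManifold (𝓡 3) ((⊤ : ℕ∞) : WithTop ℕ∞) X] [T2Space X] [SecondCountableTopology X] [ConnectedSpace X], ∀ D ∈ admissibleVacuumData X, (∀ 𝒟 : VacuumCauchyDevelopment D, 𝒟.IsMaximal → Summit.FinalStateConjecture.HasCompleteNullInfinity 𝒟.toCauchyDevelopment) → (∃ 𝒟 : VacuumCauchyDevelopment D, 𝒟.IsMaximal ∧ ¬ (∃ (O : Set 𝒟.carrier) (d : FinalStateDecomposition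 𝒟.toSpacetime O 2), O = Summit.FinalStateConjecture.exteriorOf 𝒟.toCauchyDevelopment d.charted ∧ Summit.FinalStateConjecture.RaysStayInClosure 𝒟.toCauchyDevelopment O ∧ Summit.FinalStateConjecture.HasExhaustiveCharts d ∧ Summit.FinalStateConjecture.IsFutureOriented d) ∧ ¬ (∀ [𝒟.metric.HasLeviCivita], ∀ (p : X) (γ : ℝ → 𝒟.carrier) (dom : Set ℝ), 𝒟.metric.IsNormalisedNullRayFrom 𝒟.timeOrientation 𝒟.embed 𝒟.normal p γ dom → ¬ BddAbove dom)) → ∃ (e : AFEnd X) (k : ℕ) (Φ : EuclideanSpace ℝ (Fin k) → InitialDataSet (𝓡 3) X), 2 ≤ k ∧ InitialDataSet.IsTameDataFamily e k Φ ∧ InitialDataSet.IsImmersedAtZero k Φ ∧ Function.Injective Φ ∧ Φ 0 = D ∧ (∀ c, Φ c ∈ admissibleVacuumData X) ∧ ∃ (δ : ℝ) (N : Set (EuclideanSpace ℝ (Fin k))) (m : ℕ) (g : Fin m → EuclideanSpace ℝ (Fin k) → ℝ) (L : Fin m → (EuclideanSpace ℝ (Fin k) →L[ℝ] ℝ)),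 0 < δ ∧ μH[(k : ℝ) - 1] N = 0 ∧ (∀ i, HasFDerivAt (g i) (L i) 0 ∧ L i ≠ 0) ∧ ∀ c, ‖c‖ < δ → c ≠ 0 → ¬ (∀ 𝒟 : VacuumCauchyDevelopment (Φ c), 𝒟.IsMaximal → Summit.FinalStateConjecture.HasCompleteNullInfinity 𝒟.toCauchyDevelopment ∧ ∃ (O : Set 𝒟.carrier) (d : FinalStateDecomposition 𝒟.toSpacetime O 2), (∀ i, Kerr.IsSubextremal (d.mass i) (d.spin i)) ∧ O = Summit.FinalStateConjecture.exteriorOf 𝒟.toCauchyDevelopment d.charted ∧ Summit.FinalStateConjecture.RaysStayInClosure 𝒟.toCauchyDevelopment O ∧ Summit.FinalStateConjecture.HasExhaustiveCharts d ∧ Summit.FinalStateConjecture.IsFutureOriented d) → c ∈ N ∨ ∃ i, g i c = 0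

/-! ## Registered stubs (`sorry` only here; signatures def-free and self-contained) -/

/-- **EXT — EXTREMAL-THRESHOLD CENTRES ARE PROBE-NULL** (third-law stratum of S; open-problem sized).
For every admissible datum `D` all of whose MGHDs have complete `𝓘⁺` and one of whose MGHDs `𝒟` settles HONESTLY to
finitely many Kerr black holes (`FinalStateDecomposition 𝒟.toSpacetime O 2` with `O = exteriorOf 𝒟 d.charted`,
`RaysStayInClosure`, `HasExhaustiveCharts`, `IsFutureOriented`; the structure itself only asks `|aᵢ| ≤ Mᵢ`) but admits
NO such decomposition with every hole strictly sub-extremal (`Kerr.IsSubextremal`) — i.e. the final state of `D` has an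
exactly extremal Kerr hole — `D` is the centre of a tame (one fixed end `e`), immersed-at-`0`, injective admissible
`k`-probe (`k ≥ 2`) whose punctured exceptional trace near `0` lies in a `μH[k−1]`-null set plus finitely many zero
sets `{gᵢ = 0}` of functions differentiable at `0` with non-zero differential (verbatim the conclusion of S).
Expected mechanism (route header, S1): the extremality gap `c ↦ Mᵢ(c) − |aᵢ(c)|` of the forming hole is differentiable
at `0` with non-zero derivative along an angular-momentum-shedding kick — third-law TRANSVERSALITY, extremal formation
being a threshold (codimension-one) phenomenon à la Kehle–Unger — so extremal-forming parameters lie on a wall, while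
censorship and honest weak settling are expected to persist along the probe off a `(k−1)`-null set.
Why it might fail: a DEGENERATE third law (extremality preserved to second order along a positive-measure cone of kicks:
zero differential of the gap at `0` in every direction of every tame probe); Aretakis-type horizon instability making
"settles to extremal Kerr in C²" unstable in a fat set of directions; codimension one of the extremal threshold is only
conjectured outside spherical symmetry (arXiv:2402.10190).
Sources: KehleUnger2025, arXiv:2402.10190, AngelopoulosKehleUnger2024, Aretakis2015,
Literature.Barriers.FinalStateConjecture.AretakisInstability.  Size: open-problem (XL). -/
theorem stub_extremalThresholdCentre : open Literature.Geometry.Lorentzian in open scoped Manifold MeasureTheory in ∀ (X : Type) [TopologicalSpace X] [ChartedSpace E3 X] [IsManifold (𝓡 3) ((⊤ : ℕ∞) : WithTop ℕ∞) X] [T2Space X] [SecondCountableTopology X] [ConnectedSpace X], ∀ D ∈ admissibleVacuumData X, (∀ 𝒟 : VacuumCauchyDevelopment D, 𝒟.IsMaximal → Summit.FinalStateConjecture.HasCompleteNullInfinity 𝒟.toCauchyDevelopment) → (∃ 𝒟 : VacuumCauchyDevelopment D, 𝒟.IsMaximal ∧ (∃ (O : Set 𝒟.carrier) (d : FinalStateDecomposition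 𝒟.toSpacetime O 2), O = Summit.FinalStateConjecture.exteriorOf 𝒟.toCauchyDevelopment d.charted ∧ Summit.FinalStateConjecture.RaysStayInClosure 𝒟.toCauchyDevelopment O ∧ Summit.FinalStateConjecture.HasExhaustiveCharts d ∧ Summit.FinalStateConjecture.IsFutureOriented d) ∧ ¬ (∃ (O : Set 𝒟.carrier) (d : FinalStateDecomposition 𝒟.toSpacetime O 2), (∀ i, Kerr.IsSubextremal (d.mass i) (d.spin i)) ∧ O = Summit.FinalStateConjecture.exteriorOf 𝒟.toCauchyDevelopment d.charted ∧ Summit.FinalStateConjecture.RaysStayInClosure 𝒟.toCauchyDevelopment O ∧ Summit.FinalStateConjecture.HasExhaustiveCharts d ∧ Summit.FinalStateConjecture.IsFutureOriented d)) → ∃ (e : AFEnd X) (k : ℕ) (Φ : EuclideanSpace ℝ (Fin k) → InitialDataSet (𝓡 3) X), 2 ≤ k ∧ InitialDataSet.IsTameDataFamily e k Φ ∧ InitialDataSet.IsImmersedAtZero k Φ ∧ Function.Injective Φ ∧ Φ 0 = D ∧ (∀ c, Φ c ∈ admissibleVacuumData X) ∧ ∃ (δ : ℝ) (N : Set (EuclideanSpace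 ℝ (Fin k))) (m : ℕ) (g : Fin m → EuclideanSpace ℝ (Fin k) → ℝ) (L : Fin m → (EuclideanSpace ℝ (Fin k) →L[ℝ] ℝ)), 0 < δ ∧ μH[(k : ℝ) - 1] N = 0 ∧ (∀ i, HasFDerivAt (g i) (L i) 0 ∧ L i ≠ 0) ∧ ∀ c, ‖c‖ < δ → c ≠ 0 → ¬ (∀ 𝒟 : VacuumCauchyDevelopment (Φ c), 𝒟.IsMaximal → Summit.FinalStateConjecture.HasCompleteNullInfinity 𝒟.toCauchyDevelopment ∧ ∃ (O : Set 𝒟.carrier) (d : FinalStateDecomposition 𝒟.toSpacetime O 2), (∀ i, Kerr.IsSubextremal (d.mass i) (d.spin i)) ∧ O = Summit.FinalStateConjecture.exteriorOf 𝒟.toCauchyDevelopment d.charted ∧ Summit.FinalStateConjecture.RaysStayInClosure 𝒟.toCauchyDevelopment O ∧ Summit.FinalStateConjecture.HasExhaustiveCharts d ∧ Summit.FinalStateConjecture.IsFutureOriented d) → c ∈ N ∨ ∃ i, g i c = 0 := by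
  sorry

/-- **DISP — FUTURE-NULL-COMPLETE NON-SETTLING CENTRES ARE PROBE-NULL** (dispersal / "no eternal radiator" stratum
of S; open-problem sized).
For every admissible datum `D` all of whose MGHDs have complete `𝓘⁺` and one of whose MGHDs `𝒟` admits NO honest
finitely-many-Kerr decomposition (not even with extremal holes: `¬ ∃ O d, O = exteriorOf ∧ RaysStayInClosure ∧
HasExhaustiveCharts ∧ IsFutureOriented`) although EVERY normalised future null ray from the data hypersurface is
future-complete (`IsNormalisedNullRayFrom … p γ dom → ¬ BddAbove dom`: no ray from `Σ` ends in a singularity, so by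
Penrose no closed trapped surface forms — a black-hole-free censored development that nevertheless neither disperses
(`N = 0`) nor settles), the conclusion of S holds: `D` is the centre of a tame immersed injective admissible `k`-probe
(`k ≥ 2`) with `μH[k−1]`-null-plus-finitely-many-walls punctured exceptional trace.
Expected mechanism: such a centre is an "eternal radiator" — a future causally complete, non-stationary,
non-decaying vacuum development (stationary ones are flat by Lichnerowicz; time-periodic ones are excluded near `𝓘⁺`
by Bičák–Scholtz–Tod / Alexakis–Schlue); the dispersive mechanism behind stability of Minkowski space (vector-field
decay, which is OPEN along smooth kicks) should make non-decay infinitely degenerate, hence `(k−1)`-null along a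
suitable tame probe, with the honest `N = 0` charting of the dispersing neighbours supplied by the decay estimates.
Why it might fail: large-data decay to Minkowski for null-geodesically-complete vacuum developments is open (only
small data: Christodoulou–Klainerman, Lindblad–Rodnianski); a black-hole-free non-linear "breather" could be
dynamically STABLE under smooth same-end kicks (an open island of eternal radiators), giving every probe through it a
fat exceptional trace; and the honest flat charting (`HasExhaustiveCharts` with `N = 0`, `RaysStayInClosure`) of a
slowly decaying neighbour needs quantitative peeling, not just decay.
Sources: ChristodoulouKlainerman1993, LindbladRodnianski2010, arXiv:1504.04592 (Alexakis–Schlue, no time-periodic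
vacuum), BicakScholtzTod2010, arXiv:1710.01722 (Dafermos–Luk §1.2.1), Literature.Barriers.FinalStateConjecture.KehrbergerLogarithmicAsymptotics.
Size: open-problem (XL). -/
theorem stub_nullCompleteCentre : open Literature.Geometry.Lorentzian in open scoped Manifold MeasureTheory in ∀ (X : Type) [TopologicalSpace X] [ChartedSpace E3 X] [IsManifold (𝓡 3) ((⊤ : ℕ∞) : WithTop ℕ∞) X] [T2Space X] [SecondCountableTopology X] [ConnectedSpace X], ∀ D ∈ admissibleVacuumData X, (∀ 𝒟 : VacuumCauchyDevelopment D, 𝒟.IsMaximal → Summit.FinalStateConjecture.HasCompleteNullInfinity 𝒟.toCauchyDevelopment) → (∃ 𝒟 : VacuumCauchyDevelopment D, 𝒟.IsMaximal ∧ ¬ (∃ (O : Set 𝒟.carrier) (d : FinalStateDecomposition 𝒟.toSpacetime O 2), O = Summit.FinalStateConjecture.exteriorOf 𝒟.toCauchyDevelopment d.charted ∧ Summit.FinalStateConjecture.RaysStayInClosure 𝒟.toCauchyDevelopment O ∧ Summit.FinalStateConjecture.HasExhaustiveCharts d ∧ Summit.FinalStateConjecture.IsFutureOriented d) ∧ (∀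 [𝒟.metric.HasLeviCivita], ∀ (p : X) (γ : ℝ → 𝒟.carrier) (dom : Set ℝ), 𝒟.metric.IsNormalisedNullRayFrom 𝒟.timeOrientation 𝒟.embed 𝒟.normal p γ dom → ¬ BddAbove dom)) → ∃ (e : AFEnd X) (k : ℕ) (Φ : EuclideanSpace ℝ (Fin k) → InitialDataSet (𝓡 3) X), 2 ≤ k ∧ InitialDataSet.IsTameDataFamily e k Φ ∧ InitialDataSet.IsImmersedAtZero k Φ ∧ Function.Injective Φ ∧ Φ 0 = D ∧ (∀ c, Φ c ∈ admissibleVacuumData X) ∧ ∃ (δ : ℝ) (N : Set (EuclideanSpace ℝ (Fin k))) (m : ℕ) (g : Fin m → EuclideanSpace ℝ (Fin k) → ℝ) (L : Fin m → (EuclideanSpace ℝ (Fin k) →L[ℝ] ℝ)), 0 < δ ∧ μH[(k : ℝ) - 1] N = 0 ∧ (∀ i, HasFDerivAt (g i) (L i) 0 ∧ L i ≠ 0) ∧ ∀ c, ‖c‖ < δ → c ≠ 0 → ¬ (∀ 𝒟 : VacuumCauchyDevelopment (Φ c), 𝒟.IsMaximal → Summit.FinalStateConjecture.HasCompleteNullInfinity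 𝒟.toCauchyDevelopment ∧ ∃ (O : Set 𝒟.carrier) (d : FinalStateDecomposition 𝒟.toSpacetime O 2), (∀ i, Kerr.IsSubextremal (d.mass i) (d.spin i)) ∧ O = Summit.FinalStateConjecture.exteriorOf 𝒟.toCauchyDevelopment d.charted ∧ Summit.FinalStateConjecture.RaysStayInClosure 𝒟.toCauchyDevelopment O ∧ Summit.FinalStateConjecture.HasExhaustiveCharts d ∧ Summit.FinalStateConjecture.IsFutureOriented d) → c ∈ N ∨ ∃ i, g i c = 0 := by
  sorry

/-- **BH — CENSORED BLACK-HOLE NON-SETTLING CENTRES ARE PROBE-NULL** (Kerr-basin / rigidity stratum of S;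
open-problem sized).
For every admissible datum `D` all of whose MGHDs have complete `𝓘⁺` and one of whose MGHDs `𝒟` admits NO honest
finitely-many-Kerr decomposition (not even with extremal holes) and carries a normalised future null ray from the data
hypersurface with affine domain BOUNDED ABOVE (a future-incomplete ray hidden behind the complete `𝓘⁺`: a censored
singularity, i.e. a genuine black-hole spacetime whose exterior does not settle to finitely many Kerrs moving apart —
persistent hair or oscillation, holes not separating, infinitely many holes, or an exterior that cannot be charted
honestly), the conclusion of S holds: `D` is the centre of a tame immersed injective admissible `k`-probe (`k ≥ 2`)
with `μH[k−1]`-null-plus-finitely-many-walls punctured exceptional trace.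
Expected mechanism (route header, S2): black-hole rigidity / uniqueness (stationary censored vacuum black-hole
exteriors are Kerr) plus asymptotic stability of the sub-extremal Kerr family with honest, future-oriented,
horizon-normalised charts (the Kerr basin is open and captures a.e. kick of a censored black-hole datum) make this
class infinitely degenerate: along a suitable tame probe the non-settling parameters are `(k−1)`-null, extremal
end-states of neighbours sitting on finitely many walls.
Why it might fail: Kerr capture with honest charts is known only for `|a| ≪ M` (KlainermanSzeftel2023,
arXiv:2205.14808); a censored black-hole development with a quasi-periodic or hairy exterior could be STABLE along
every smooth same-end kick (an open island of non-Kerr final behaviour), giving every probe a fat trace; rigidity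
without analyticity / near-Kerr assumptions is open (AIK); multi-hole configurations that never separate are not
excluded by any known mechanism.
Sources: KlainermanSzeftel2023, arXiv:2205.14808, DafermosHolzegelRodnianskiTaylor2021, arXiv:0902.1173
(Alexakis–Ionescu–Klainerman), arXiv:1710.01722, Literature.Barriers.FinalStateConjecture.SlowlyRotatingKerrFrontier.
Size: open-problem (XL). -/
theorem stub_blackHoleCentre : open Literature.Geometry.Lorentzian in open scoped Manifold MeasureTheory in ∀ (X : Type) [TopologicalSpace X] [ChartedSpace E3 X] [IsManifold (𝓡 3) ((⊤ : ℕ∞) : WithTop ℕ∞) X] [T2Space X] [SecondCountableTopology X] [ConnectedSpace X], ∀ D ∈ admissibleVacuumData X, (∀ 𝒟 : VacuumCauchyDevelopment D, 𝒟.IsMaximal → Summit.FinalStateConjecture.HasCompleteNullInfinity 𝒟.toCauchyDevelopment) → (∃ 𝒟 : VacuumCauchyDevelopment D, 𝒟.IsMaximal ∧ ¬ (∃ (O : Set 𝒟.carrier) (d : FinalStateDecomposition 𝒟.toSpacetime O 2), O = Summit.FinalStateConjecture.exteriorOf 𝒟.toCauchyDevelopment d.charted ∧ Summit.FinalStateConjecture.RaysStayInClosure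 𝒟.toCauchyDevelopment O ∧ Summit.FinalStateConjecture.HasExhaustiveCharts d ∧ Summit.FinalStateConjecture.IsFutureOriented d) ∧ ¬ (∀ [𝒟.metric.HasLeviCivita], ∀ (p : X) (γ : ℝ → 𝒟.carrier) (dom : Set ℝ), 𝒟.metric.IsNormalisedNullRayFrom 𝒟.timeOrientation 𝒟.embed 𝒟.normal p γ dom → ¬ BddAbove dom)) → ∃ (e : AFEnd X) (k : ℕ) (Φ : EuclideanSpace ℝ (Fin k) → InitialDataSet (𝓡 3) X), 2 ≤ k ∧ InitialDataSet.IsTameDataFamily e k Φ ∧ InitialDataSet.IsImmersedAtZero k Φ ∧ Function.Injective Φ ∧ Φ 0 = D ∧ (∀ c, Φ c ∈ admissibleVacuumData X) ∧ ∃ (δ : ℝ) (N : Set (EuclideanSpace ℝ (Fin k))) (m : ℕ) (g : Fin m → EuclideanSpace ℝ (Fin k) → ℝ) (L : Fin m → (EuclideanSpace ℝ (Fin k) →L[ℝ] ℝ)), 0 < δ ∧ μH[(k : ℝ) - 1] N = 0 ∧ (∀ i, HasFDerivAt (g i) (L i) 0 ∧ L i ≠ 0) ∧ ∀ c, ‖c‖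 < δ → c ≠ 0 → ¬ (∀ 𝒟 : VacuumCauchyDevelopment (Φ c), 𝒟.IsMaximal → Summit.FinalStateConjecture.HasCompleteNullInfinity 𝒟.toCauchyDevelopment ∧ ∃ (O : Set 𝒟.carrier) (d : FinalStateDecomposition 𝒟.toSpacetime O 2), (∀ i, Kerr.IsSubextremal (d.mass i) (d.spin i)) ∧ O = Summit.FinalStateConjecture.exteriorOf 𝒟.toCauchyDevelopment d.charted ∧ Summit.FinalStateConjecture.RaysStayInClosure 𝒟.toCauchyDevelopment O ∧ Summit.FinalStateConjecture.HasExhaustiveCharts d ∧ Summit.FinalStateConjecture.IsFutureOriented d) → c ∈ N ∨ ∃ i, g i c = 0 := by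
  sorry

/-! ## Composition: the crux BY NAME from the three stubs (real proof, no `sorry`) -/

/-- **S from EXT, DISP and BH**: fix `X`, an admissible `D` all of whose MGHDs have complete `𝓘⁺`, and a maximal `𝒟`
failing the settled clause.  Either `𝒟` settles honestly with possibly extremal holes (then, as it does not settle
sub-extremally, `D` is an EXT centre); or it does not, and then either every normalised future null ray from the data
hypersurface is future-complete (a DISP centre) or some ray is incomplete (a BH centre).  In each case the matching stub
returns the tame probe with null-plus-walls punctured trace that S demands. -/
theorem SettlingTraceNull_of :
    Sig.stub_extremalThresholdCentre → Sig.stub_nullCompleteCentre → Sig.stub_blackHoleCentre →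
      SettlingTraceNull := by
  intro hE hN hB X _ _ _ _ _ _ D hD hcomp hfail
  obtain ⟨𝒟, hmax, hns⟩ := hfail
  by_cases hW : ∃ (O : Set 𝒟.carrier) (d : FinalStateDecomposition 𝒟.toSpacetime O 2),
      O = Summit.FinalStateConjecture.exteriorOf 𝒟.toCauchyDevelopment d.charted ∧
        Summit.FinalStateConjecture.RaysStayInClosure 𝒟.toCauchyDevelopment O ∧
          Summit.FinalStateConjecture.HasExhaustiveCharts d ∧ Summit.FinalStateConjecture.IsFutureOriented d
  · exact hE X D hD hcomp ⟨𝒟, hmax, hW, hns⟩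
  · by_cases hC : ∀ [𝒟.metric.HasLeviCivita], ∀ (p : X) (γ : ℝ → 𝒟.carrier) (dom : Set ℝ),
        𝒟.metric.IsNormalisedNullRayFrom 𝒟.timeOrientation 𝒟.embed 𝒟.normal p γ dom → ¬ BddAbove dom
    · exact hN X D hD hcomp ⟨𝒟, hmax, hW, hC⟩
    · exact hB X D hD hcomp ⟨𝒟, hmax, hW, hC⟩

/-- The crux by name, closed modulo the three registered stubs. -/
theorem settlingTraceNull_of_stubs : SettlingTraceNull :=
  SettlingTraceNull_of stub_extremalThresholdCentre stub_nullCompleteCentre stub_blackHoleCentre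

end Summit.FinalStateConjecture.FinalStateConjecture.Cruxes.SettlingTraceNull.Birth
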